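import Mathlib.Analysis.SpecialFunctions.Complex.Log
import Mathlib.Analysis.SpecialFunctions.Complex.Circle
import Mathlib.Topology.Maps.Proper.CompactlyGenerated
import Mathlib.Analysis.Normed.Group.CocompactMap
import Mathlib.Topology.Order.IntermediateValue
import Literature.Topology.PlaneTopology.Janiszewski
import HarnessLib

/-!
# Homeomorphisms of a circle extend over an annulus: the Alexander–Schoenflies twist

Topic: Topology / PlaneTopology. The elementary half of the classification of self-homeomorphisms
of the circle up to isotopy (H. Kneser 1926; e.g. E. E. Moise, *Geometric topology in dimensions
2 and 3* (1977), Ch. 4 and Ch. 11, Thm. 4 "every homeomorphism of a 1-sphere onto itself is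
isotopic either to the identity or to a reflection"), in the concrete form needed to correct
boundary values in cut-and-paste constructions of plane homeomorphisms (the two-dimensional
annulus theorem, `AnnulusTheorem.lean`):

* `CircleTwist.turn t = e^{2πit}` and its elementary properties;
* **lifting** (`exists_lift_circle`): a continuous self-map `k` of the circle `‖z‖ = 2` lifts
  to a continuous `K : ℝ → ℝ` with `k (2e^{2πit}) = 2e^{2πiK(t)}` and `K (t + 1) = K t + d` for an
  integer `d` (covering `exp : ℂ → ℂˣ`, through the tree's `Janiszewski.exists_continuous_log`);
* **degree `±1`** (`strictMono_of_lift`): if `k` is injective, a lift increasing on `(0, 1)`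
  has `d = 1` and is strictly increasing on `ℝ` (intermediate value theorem);
* **the twist** (`CircleTwist.twist`): for `K` continuous, strictly increasing with
  `K (t + 1) = K t + 1`, the map `ρ e^{2πit} ↦ ρ e^{2πi (t + c(ρ)(K t - t))}`, `c(ρ) = ρ - 1`
  clamped to `[0, 1]`, is a norm-preserving homeomorphism of `ℂ` which is the identity on the
  closed unit disc and the radial extension of `k` outside the disc of radius `2` (the linear
  isotopy `(1 - c) id + c K` of increasing lifts, levelled along the radius);
* **main result** (`exists_homeomorph_extend_circle`): *every homeomorphism `k` of the circle
  `‖z‖ = 2` onto itself is the restriction of a norm-preserving homeomorphism `Φ` of `ℂ` which on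
  the closed unit disc is either the identity or complex conjugation* — the identity when `k`
  preserves orientation, conjugation (composed into the twist) when it reverses it.

Mathlib has the covering map `Complex.exp` (`Complex.isCoveringMapOn_exp`), rotation numbers of
degree-one circle lifts (`CircleDeg1Lift`, for monotone lifts given in advance) and
`Continuous.strictMono_of_inj`; it has no lifting of circle homeomorphisms with the degree
dichotomy and no such extension statement (searched `CircleDeg1Lift`, `AddCircle`,
`Homeomorph.*circle`, `isotop`).

## References

* E. E. Moise, *Geometric topology in dimensions 2 and 3*, GTM 47, Springer (1977), Ch. 11.
* H. Kneser, *Die Deformationssätze der einfach zusammenhängenden Flächen*, Math. Z. 25 (1926)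
  362–372.
-/

noncomputable section

namespace Literature.Topology.PlaneTopology

open Set Metric Real Filter _root_.Topology Complex

namespace CircleTwist

/-! ### The exponential parametrisation of the unit circle by turns -/

/-- `turn t = e^{2πit}`, the point of the unit circle at `t` turns. [folklore] -/
def turn (t : ℝ) : ℂ := exp (2 * π * t * I)

/-- `turn t = exp ((2πt) i)` with a real coefficient. [folklore] -/
theorem turn_eq (t : ℝ) : turn t = exp (((2 * π * t : ℝ) : ℂ) * I) := by
  unfold turn; push_cast; ring_nf

/-- Points of the form `turn t` have norm one. [folklore] -/
@[simp] theorem norm_turn (t : ℝ) : ‖turn t‖ = 1 := by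
  rw [turn_eq, norm_exp_ofReal_mul_I]

/-- `turn t ≠ 0`. [folklore] -/
theorem turn_ne_zero (t : ℝ) : turn t ≠ 0 := by
  rw [← norm_pos_iff, norm_turn]; exact one_pos

/-- `turn` is continuous. [folklore] -/
@[fun_prop] theorem continuous_turn : Continuous turn := by
  unfold turn; fun_prop

/-- `turn 0 = 1`. [folklore] -/
@[simp] theorem turn_zero : turn 0 = 1 := by simp [turn]

/-- Addition formula. [folklore] -/
theorem turn_add (s t : ℝ) : turn (s + t) = turn s * turn t := by
  unfold turn; rw [← Complex.exp_add]; push_cast; ring_nf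

/-- `turn` is `1`-periodic: integers give `1`. [folklore] -/
@[simp] theorem turn_intCast (n : ℤ) : turn n = 1 := by
  unfold turn
  have : (2 : ℂ) * π * ((n : ℝ) : ℂ) * I = n * (2 * π * I) := by push_cast; ring
  rw [this, Complex.exp_int_mul_two_pi_mul_I]

/-- `turn (t + n) = turn t` for an integer `n`. [folklore] -/
theorem turn_add_intCast (t : ℝ) (n : ℤ) : turn (t + n) = turn t := by
  rw [turn_add, turn_intCast, mul_one]

/-- `turn (t + 1) = turn t`. [folklore] -/
theorem turn_add_one (t : ℝ) : turn (t + 1) = turn t := by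
  simpa using turn_add_intCast t 1

/-- `turn (-t)` is the conjugate of `turn t`. [folklore] -/
theorem turn_neg (t : ℝ) : turn (-t) = (starRingEnd ℂ) (turn t) := by
  unfold turn
  rw [← Complex.exp_conj]
  congr 1
  simp only [map_mul, Complex.conj_ofReal, Complex.conj_I, map_ofNat]
  push_cast
  ring

/-- **`turn s = turn t` iff `s - t` is an integer.** [folklore] -/
theorem turn_eq_turn_iff {s t : ℝ} : turn s = turn t ↔ ∃ n : ℤ, s = t + n := by
  unfold turn
  rw [Complex.exp_eq_exp_iff_exists_int]
  constructor
  · rintro ⟨n, hn⟩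
    refine ⟨n, ?_⟩
    have h2 : (2 * π * I : ℂ) ≠ 0 := by simp [pi_ne_zero, I_ne_zero]
    have : ((s : ℂ) - (t + n)) * (2 * π * I) = 0 := by linear_combination hn
    rcases mul_eq_zero.1 this with h | h
    · exact_mod_cast (sub_eq_zero.1 h)
    · exact absurd h h2
  · rintro ⟨n, rfl⟩
    exact ⟨n, by push_cast; ring⟩

/-- Polar form: `‖z‖ * turn (arg z / (2π)) = z` for every `z`. [folklore] -/
theorem norm_mul_turn_arg (z : ℂ) : (‖z‖ : ℂ) * turn (arg z / (2 * π)) = z := by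
  rw [turn_eq]
  have : 2 * π * (arg z / (2 * π)) = arg z := by field_simp
  rw [this]
  exact norm_mul_exp_arg_mul_I z

/-- Every point of the unit circle is `turn t` for some `t`. [folklore] -/
theorem exists_turn_eq {w : ℂ} (hw : ‖w‖ = 1) : ∃ t, turn t = w :=
  ⟨arg w / (2 * π), by simpa [hw] using norm_mul_turn_arg w⟩

/-- `exp` of a purely imaginary number in turns: `exp (x) = e^{re x} turn (im x / 2π)`.
[folklore] -/
theorem exp_eq_exp_re_mul_turn (x : ℂ) : exp x = Real.exp x.re * turn (x.im / (2 * π)) := by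
  rw [turn_eq]
  have : 2 * π * (x.im / (2 * π)) = x.im := by field_simp
  rw [this]
  conv_lhs => rw [← re_add_im x, Complex.exp_add]
  push_cast
  ring_nf

/-! ### Lifting a circle map through `turn` -/

/-- **Lifting a continuous self-map of the circle `‖z‖ = 2`.** There is a continuous
`K : ℝ → ℝ` with `k (2 turn t) = 2 turn (K t)`, and an integer `d` (the degree) with
`K (t + 1) = K t + d`. (Lift `t ↦ k (2e^{2πit})` through the covering `exp`, via the tree's
`Janiszewski.exists_continuous_log`; the difference `K (t+1) - K t` is a continuous
integer-valued function.) [folklore] -/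
theorem exists_lift_circle {k : ℂ → ℂ} (hkc : ContinuousOn k (sphere 0 2))
    (hk : MapsTo k (sphere 0 2) (sphere 0 2)) :
    ∃ K : ℝ → ℝ, Continuous K ∧ (∀ t, k (2 * turn t) = 2 * turn (K t)) ∧
      ∃ d : ℤ, ∀ t, K (t + 1) = K t + d := by
  have hsph : ∀ t : ℝ, 2 * turn t ∈ sphere (0 : ℂ) 2 := fun t => by
    simp [norm_turn]
  set h : ℂ → ℂ := fun z => k (2 * turn z.re) with hh
  have hhc : Continuous h := by
    refine hkc.comp_continuous (by fun_prop) fun z => hsph _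
  have hh2 : ∀ z, ‖h z‖ = 2 := fun z => mem_sphere_zero_iff_norm.1 (hk (hsph _))
  have hh0 : ∀ z, h z ≠ 0 := fun z => by
    rw [← norm_pos_iff, hh2]; exact two_pos
  obtain ⟨H, hHc, hH⟩ := Janiszewski.exists_continuous_log hhc hh0
  set K : ℝ → ℝ := fun t => (H t).im / (2 * π) with hK
  have hKc : Continuous K := by
    have : Continuous fun t : ℝ => H t := hHc.comp continuous_ofReal
    exact (continuous_im.comp this).div_const _
  have hre : ∀ t : ℝ, Real.exp (H t).re = 2 := fun t => by
    have := congrArg norm (hH t)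
    rwa [norm_exp, hh2] at this
  have hkey : ∀ t : ℝ, k (2 * turn t) = 2 * turn (K t) := fun t => by
    have h1 : h t = k (2 * turn t) := by simp [hh]
    rw [← h1, ← hH t, exp_eq_exp_re_mul_turn, hre]
    norm_cast
  refine ⟨K, hKc, hkey, ?_⟩
  -- the degree
  have hint : ∀ t : ℝ, ∃ n : ℤ, K (t + 1) = K t + n := fun t => by
    have e : turn (K (t + 1)) = turn (K t) := by
      have h1 := hkey (t + 1)
      rw [turn_add_one, hkey t] at h1
      exact (mul_left_cancel₀ two_ne_zero h1).symm
    exact turn_eq_turn_iff.1 e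
  set T : Set ℝ := (AddSubgroup.zmultiples (1 : ℝ) : Set ℝ) with hT
  have hTd : IsDiscrete T :=
    isDiscrete_iff_discreteTopology.2 (NormedSpace.discreteTopology_zmultiples _)
  have hmaps : MapsTo (fun t => K (t + 1) - K t) univ T := fun t _ => by
    obtain ⟨n, hn⟩ := hint t
    rw [hT, SetLike.mem_coe, AddSubgroup.mem_zmultiples_iff]
    refine ⟨n, ?_⟩
    show n • (1 : ℝ) = K (t + 1) - K t
    rw [hn, zsmul_eq_mul, mul_one]; ring
  have hcont : ContinuousOn (fun t => K (t + 1) - K t) univ :=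
    ((hKc.comp (continuous_id.add continuous_const)).sub hKc).continuousOn
  obtain ⟨d, hd⟩ := hint 0
  refine ⟨d, fun t => ?_⟩
  have := isPreconnected_univ.constant_of_mapsTo hTd hcont hmaps (mem_univ t) (mem_univ 0)
  simp only [zero_add] at this hd
  linarith [this, hd]

/-! ### Degree `±1` for injective circle maps -/

/-- A lift commuting with the unit deck translation commutes with all integer translations:
`K (t + n) = K t + n`. [folklore] -/
theorem apply_add_intCast_of_add_one {K : ℝ → ℝ} (hK1 : ∀ t, K (t + 1) = K t + 1) (t : ℝ)
    (n : ℤ) : K (t + n) = K t + n := by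
  induction n using Int.induction_on with
  | zero => simp
  | succ m ih =>
    have := hK1 (t + m)
    push_cast at ih ⊢
    rw [show t + ((m : ℝ) + 1) = t + m + 1 by ring, this, ih]
    ring
  | pred m ih =>
    have := hK1 (t + (-(m : ℝ) - 1))
    rw [show t + (-(m : ℝ) - 1) + 1 = t + -(m : ℝ) by ring] at this
    push_cast at ih ⊢
    linarith

/-- From strict monotonicity on the open unit interval to the closed one, for a continuous
function. [folklore] -/
theorem strictMonoOn_Icc_of_Ioo {K : ℝ → ℝ} (hKc : Continuous K)
    (hm : StrictMonoOn K (Ioo 0 1)) : StrictMonoOn K (Icc 0 1) := by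
  -- one-sided limits give the weak inequalities at the end-points
  have h0 : ∀ t ∈ Ioo (0 : ℝ) 1, K 0 ≤ K t := fun t ht => by
    have hlim : Tendsto K (𝓝[>] 0) (𝓝 (K 0)) := (hKc.tendsto 0).mono_left nhdsWithin_le_nhds
    refine le_of_tendsto hlim ?_
    filter_upwards [Ioo_mem_nhdsGT ht.1] with s hs
    exact (hm ⟨hs.1, hs.2.trans ht.2⟩ ht hs.2).le
  have h1 : ∀ t ∈ Ioo (0 : ℝ) 1, K t ≤ K 1 := fun t ht => by
    have hlim : Tendsto K (𝓝[<] 1) (𝓝 (K 1)) := (hKc.tendsto 1).mono_left nhdsWithin_le_nhds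
    refine ge_of_tendsto hlim ?_
    filter_upwards [Ioo_mem_nhdsLT ht.2] with s hs
    exact (hm ht ⟨ht.1.trans hs.1, hs.2⟩ hs.1).le
  have h0' : ∀ t ∈ Ioo (0 : ℝ) 1, K 0 < K t := fun t ht =>
    (h0 (t / 2) ⟨by linarith [ht.1], by linarith [ht.2]⟩).trans_lt
      (hm ⟨by linarith [ht.1], by linarith [ht.2]⟩ ht (by linarith [ht.1]))
  have h1' : ∀ t ∈ Ioo (0 : ℝ) 1, K t < K 1 := fun t ht =>
    (hm ht ⟨by linarith [ht.1], by linarith [ht.2]⟩ (by linarith [ht.2] : t < (t + 1) / 2)).trans_le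
      (h1 ((t + 1) / 2) ⟨by linarith [ht.1], by linarith [ht.2]⟩)
  have h01 : K 0 < K 1 := (h0' (1 / 2) (by norm_num)).trans (h1' (1 / 2) (by norm_num))
  intro s hs t ht hst
  rcases hs.1.eq_or_lt with rfl | hs0
  · rcases ht.2.eq_or_lt with rfl | ht1
    · exact h01
    · exact h0' t ⟨hst, ht1⟩
  · rcases ht.2.eq_or_lt with rfl | ht1
    · exact h1' s ⟨hs0, hst⟩
    · exact hm ⟨hs0, hst.trans ht1⟩ ⟨hs0.trans hst, ht1⟩ hst

/-- **An injective circle map with increasing lift has degree one and a strictly increasing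
lift.** If `K` is continuous, `K (t + 1) = K t + d` for an integer `d`, `K` is strictly
increasing on `(0, 1)`, and `turn (K s) = turn (K t)` only when `turn s = turn t` (injectivity
of the circle map), then `d = 1` and `K` is strictly increasing. [folklore] -/
theorem strictMono_of_lift {K : ℝ → ℝ} {d : ℤ} (hKc : Continuous K) (hK1 : ∀ t, K (t + 1) = K t + d)
    (hm : StrictMonoOn K (Ioo 0 1))
    (hinj : ∀ s t, turn (K s) = turn (K t) → turn s = turn t) : d = 1 ∧ StrictMono K := by
  have hmI : StrictMonoOn K (Icc 0 1) := strictMonoOn_Icc_of_Ioo hKc hm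
  have h01 : K 0 < K 1 := hmI (left_mem_Icc.2 zero_le_one) (right_mem_Icc.2 zero_le_one) one_pos
  have hK10 : K 1 = K 0 + d := by simpa using hK1 0
  have hd_pos : (0 : ℝ) < d := by linarith
  have hd1 : (1 : ℤ) ≤ d := by exact_mod_cast (show (0 : ℤ) < d by exact_mod_cast hd_pos)
  -- `d ≤ 1` by the intermediate value theorem and injectivity
  have hd : d = 1 := by
    by_contra hne
    have hd2 : (2 : ℝ) ≤ d := by exact_mod_cast (show (2 : ℤ) ≤ d by omega)
    have hmem : K 0 + 1 ∈ Icc (K 0) (K 1) := ⟨by linarith, by linarith⟩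
    obtain ⟨t, ht, hKt⟩ := intermediate_value_Icc zero_le_one hKc.continuousOn hmem
    have e : turn (K t) = turn (K 0) := by
      rw [hKt, show K 0 + 1 = K 0 + ((1 : ℤ) : ℝ) by simp, turn_add_intCast]
    obtain ⟨n, hn⟩ := turn_eq_turn_iff.1 (hinj t 0 e)
    rw [zero_add] at hn
    -- `t ∈ [0, 1]` is an integer: `t = 0` or `t = 1`, both impossible
    have hn01 : n = 0 ∨ n = 1 := by
      have h0 : (0 : ℝ) ≤ n := hn ▸ ht.1
      have h1 : (n : ℝ) ≤ 1 := hn ▸ ht.2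
      have : (0 : ℤ) ≤ n := by exact_mod_cast h0
      have : n ≤ (1 : ℤ) := by exact_mod_cast h1
      omega
    rcases hn01 with rfl | rfl
    · simp only [Int.cast_zero] at hn; rw [hn] at hKt; linarith
    · simp only [Int.cast_one] at hn; rw [hn, hK10] at hKt
      have : (d : ℝ) = 1 := by linarith
      exact hne (by exact_mod_cast this)
  refine ⟨hd, ?_⟩
  subst hd
  simp only [Int.cast_one] at hK1
  -- global strict monotonicity from `K (t + n) = K t + n`
  have hKn : ∀ (t : ℝ) (n : ℤ), K (t + n) = K t + n := apply_add_intCast_of_add_one hK1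
  intro s t hst
  -- reduce `s` to `[0, 1)`
  set m : ℤ := ⌊s⌋ with hm_def
  set s' := s - m with hs'
  set t' := t - m with ht'
  have hs'0 : 0 ≤ s' := by rw [hs']; linarith [Int.floor_le s]
  have hs'1 : s' < 1 := by rw [hs']; linarith [Int.lt_floor_add_one s]
  have hs't' : s' < t' := by rw [hs', ht']; linarith
  have hKs : K s = K s' + m := by rw [← hKn s' m, hs']; ring_nf
  have hKt : K t = K t' + m := by rw [← hKn t' m, ht']; ring_nf
  rw [hKs, hKt]
  suffices K s' < K t' by linarith
  rcases le_or_gt t' 1 with ht'1 | ht'1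
  · exact hmI ⟨hs'0, hs'1.le⟩ ⟨hs'0.trans hs't'.le, ht'1⟩ hs't'
  · -- `t' > 1`: go through `K 1 = K 0 + 1 ≤ K t'`
    have hlt : K s' < K 1 := hmI ⟨hs'0, hs'1.le⟩ (right_mem_Icc.2 zero_le_one) hs'1
    set n : ℤ := ⌊t'⌋ with hn_def
    have hn1 : (1 : ℝ) ≤ n := by
      have : (1 : ℤ) ≤ n := Int.le_floor.2 (by exact_mod_cast ht'1.le)
      exact_mod_cast this
    have ht''0 : 0 ≤ t' - n := by linarith [Int.floor_le t']
    have ht''1 : t' - n < 1 := by linarith [Int.lt_floor_add_one t']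
    have hK0le : K 0 ≤ K (t' - n) := hmI.monotoneOn (left_mem_Icc.2 zero_le_one)
      ⟨ht''0, ht''1.le⟩ ht''0
    have hKt' : K t' = K (t' - n) + n := by rw [← hKn (t' - n) n]; ring_nf
    have hK1' : K 1 = K 0 + 1 := by simpa using hK1 0
    rw [hKt']
    linarith

/-! ### The twist homeomorphism -/

section Twist

variable {K : ℝ → ℝ} (hKc : Continuous K) (hKm : StrictMono K) (hK1 : ∀ t, K (t + 1) = K t + 1)

/-- The linear isotopy of lifts: `B c t = t + c (K t - t)`. [folklore] -/
def blend (K : ℝ → ℝ) (c t : ℝ) : ℝ := t + c * (K t - t)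

/-- The isotopy parameter as a function of the radius: `ρ - 1` clamped to `[0, 1]`. [folklore] -/
def clamp (ρ : ℝ) : ℝ := max 0 (min 1 (ρ - 1))

/-- `clamp ρ ∈ [0, 1]`. [folklore] -/
theorem clamp_mem (ρ : ℝ) : clamp ρ ∈ Icc (0 : ℝ) 1 :=
  ⟨le_max_left _ _, max_le zero_le_one (min_le_left _ _)⟩

/-- `clamp ρ = 0` for `ρ ≤ 1`. [folklore] -/
theorem clamp_of_le_one {ρ : ℝ} (h : ρ ≤ 1) : clamp ρ = 0 := by
  unfold clamp; rw [max_eq_left]; exact (min_le_right _ _).trans (by linarith)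

/-- `clamp ρ = 1` for `2 ≤ ρ`. [folklore] -/
theorem clamp_of_two_le {ρ : ℝ} (h : 2 ≤ ρ) : clamp ρ = 1 := by
  unfold clamp; rw [min_eq_left (by linarith), max_eq_right zero_le_one]

/-- `clamp` is continuous. [folklore] -/
@[fun_prop] theorem continuous_clamp : Continuous clamp := by unfold clamp; fun_prop

/-- **The twist**: `ρ e^{2πit} ↦ ρ e^{2πi B(clamp ρ, t)}`, written with the principal argument.
[folklore] -/
def twist (K : ℝ → ℝ) (z : ℂ) : ℂ := (‖z‖ : ℂ) * turn (blend K (clamp ‖z‖) (arg z / (2 * π)))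

include hK1 in
/-- The isotopy commutes with the deck translation: `B c (t + n) = B c t + n`. [folklore] -/
theorem blend_add_intCast (c t : ℝ) (n : ℤ) : blend K c (t + n) = blend K c t + n := by
  unfold blend; rw [apply_add_intCast_of_add_one hK1]; ring

/-- The isotopy is jointly continuous. [folklore] -/
theorem continuous_blend (hKc : Continuous K) : Continuous fun p : ℝ × ℝ => blend K p.1 p.2 := by
  unfold blend; fun_prop

include hKm in
/-- Each stage of the isotopy is strictly increasing. [folklore] -/
theorem strictMono_blend {c : ℝ} (hc : c ∈ Icc (0 : ℝ) 1) : StrictMono (blend K c) := by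
  have e : blend K c = fun t => (1 - c) * t + c * K t := by
    ext t; unfold blend; ring
  rw [e]
  rcases hc.1.eq_or_lt with rfl | hc0
  · intro a b h; simpa using h
  · exact (monotone_id.const_mul (by linarith [hc.2])).add_strictMono (hKm.const_mul hc0)

include hKc hK1 in
/-- Each stage of the isotopy is surjective. [folklore] -/
theorem surjective_blend (c : ℝ) : Function.Surjective (blend K c) := by
  intro y
  have hc' : Continuous (blend K c) := by unfold blend; fun_prop
  set N : ℕ := ⌈|y - blend K c 0|⌉₊ with hN
  have hN' : |y - blend K c 0| ≤ N := Nat.le_ceil _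
  have hlo : blend K c (-(N : ℝ)) ≤ y := by
    have := blend_add_intCast hK1 c 0 (-(N : ℤ))
    simp only [Int.cast_neg, Int.cast_natCast, zero_add] at this
    rw [this]; linarith [abs_le.1 hN']
  have hhi : y ≤ blend K c N := by
    have := blend_add_intCast hK1 c 0 (N : ℤ)
    simp only [Int.cast_natCast, zero_add] at this
    rw [this]; linarith [abs_le.1 hN']
  obtain ⟨t, -, ht⟩ := intermediate_value_Icc (by linarith : (-(N : ℝ)) ≤ N) hc'.continuousOn
    ⟨hlo, hhi⟩
  exact ⟨t, ht⟩

include hK1 in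
/-- If `turn s = turn t` then the twisted angles agree on the circle:
`turn (B c s) = turn (B c t)`. [folklore] -/
theorem turn_blend_eq_of_turn_eq {c s t : ℝ} (h : turn s = turn t) :
    turn (blend K c s) = turn (blend K c t) := by
  obtain ⟨n, rfl⟩ := turn_eq_turn_iff.1 h
  rw [blend_add_intCast hK1, turn_add_intCast]

include hK1 in
/-- **The twist in polar form**: `twist (ρ turn t) = ρ turn (B (clamp ρ) t)` for `ρ ≥ 0`.
[folklore] -/
theorem twist_polar {ρ : ℝ} (hρ : 0 ≤ ρ) (t : ℝ) :
    twist K (ρ * turn t) = ρ * turn (blend K (clamp ρ) (t)) := by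
  have hn : ‖(ρ : ℂ) * turn t‖ = ρ := by simp [norm_turn, abs_of_nonneg hρ]
  unfold twist
  rw [hn]
  rcases hρ.eq_or_lt with rfl | hρ'
  · simp
  · congr 1
    apply turn_blend_eq_of_turn_eq hK1
    have h := norm_mul_turn_arg ((ρ : ℂ) * turn t)
    rw [hn] at h
    exact mul_left_cancel₀ (by exact_mod_cast hρ'.ne') h

/-- The twist preserves the norm. [folklore] -/
theorem norm_twist (z : ℂ) : ‖twist K z‖ = ‖z‖ := by
  unfold twist; simp [norm_turn]

/-- The twist is the identity on the closed unit disc. [folklore] -/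
theorem twist_of_norm_le_one {z : ℂ} (hz : ‖z‖ ≤ 1) : twist K z = z := by
  unfold twist blend
  rw [clamp_of_le_one hz, zero_mul, add_zero, norm_mul_turn_arg]

/-- Outside the disc of radius `2` the twist is the radial extension of `t ↦ turn (K t)`:
`twist (ρ turn t) = ρ turn (K t)` for `ρ ≥ 2`. [folklore] -/
theorem twist_polar_of_two_le (hK1 : ∀ t, K (t + 1) = K t + 1) {ρ : ℝ} (hρ : 2 ≤ ρ) (t : ℝ) :
    twist K (ρ * turn t) = ρ * turn (K t) := by
  rw [twist_polar hK1 (by linarith) t, clamp_of_two_le hρ]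
  unfold blend; ring_nf

include hKc hK1 in
/-- **Continuity of the twist.** Near `z₀ ≠ 0` a continuous branch of the argument is
`arg z₀ + im (log (z / z₀))`, and the twist does not depend on the branch; at `0` the twist
preserves the norm. [folklore] -/
theorem continuous_twist : Continuous (twist K) := by
  have hB : Continuous fun p : ℝ × ℝ => blend K p.1 p.2 := continuous_blend hKc
  rw [continuous_iff_continuousAt]
  intro z₀
  rcases eq_or_ne z₀ 0 with rfl | hz₀
  · -- at the origin
    rw [ContinuousAt, show twist K 0 = 0 by simp [twist]]
    refine tendsto_zero_iff_norm_tendsto_zero.2 ?_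
    simp_rw [norm_twist]
    exact continuous_norm.tendsto' 0 0 norm_zero
  · -- away from the origin: a local continuous branch of the argument
    set τ₀ : ℝ := arg z₀ / (2 * π) with hτ₀
    set τ : ℂ → ℝ := fun z => τ₀ + (Complex.log (z / z₀)).im / (2 * π) with hτ
    have hτc : ContinuousAt τ z₀ := by
      have h1 : ContinuousAt (fun z : ℂ => Complex.log (z / z₀)) z₀ := by
        refine ContinuousAt.comp (g := Complex.log) ?_ (continuousAt_id.div_const z₀)
        rw [div_self hz₀]
        exact continuousAt_clog (by simp [slitPlane])
      exact continuousAt_const.add ((continuous_im.continuousAt.comp h1).div_const _)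
    -- the polar identity `z = ‖z‖ turn (τ z)` for `z ≠ 0`
    have hpolar : ∀ z, z ≠ 0 → ((‖z‖ : ℝ) : ℂ) * turn (τ z) = z := by
      intro z hz
      have hw : z / z₀ ≠ 0 := div_ne_zero hz hz₀
      rw [hτ]
      dsimp only
      rw [turn_add]
      have h1 : (‖z₀‖ : ℂ) * turn τ₀ = z₀ := norm_mul_turn_arg z₀
      have h2 : (‖z / z₀‖ : ℂ) * turn ((Complex.log (z / z₀)).im / (2 * π)) = z / z₀ := by
        rw [Complex.log_im]; exact norm_mul_turn_arg (z / z₀)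
      have hn0 : (‖z₀‖ : ℂ) ≠ 0 := by exact_mod_cast (norm_ne_zero_iff.2 hz₀)
      have hn : (‖z / z₀‖ : ℂ) ≠ 0 := by exact_mod_cast (norm_ne_zero_iff.2 hw)
      have e1 : turn τ₀ = z₀ / ‖z₀‖ := by rw [eq_div_iff hn0, mul_comm]; exact h1
      have e2 : turn ((Complex.log (z / z₀)).im / (2 * π)) = (z / z₀) / ‖z / z₀‖ := by
        rw [eq_div_iff hn, mul_comm]; exact h2
      have hnz : (‖z‖ : ℂ) ≠ 0 := by exact_mod_cast (norm_ne_zero_iff.2 hz)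
      rw [e1, e2, norm_div]
      push_cast
      field_simp
    have heq : ∀ z, z ≠ 0 → twist K z = (‖z‖ : ℂ) * turn (blend K (clamp ‖z‖) (τ z)) := by
      intro z hz
      conv_lhs => rw [← hpolar z hz]
      rw [twist_polar hK1 (norm_nonneg z)]
    have hev : (fun z => (‖z‖ : ℂ) * turn (blend K (clamp ‖z‖) (τ z))) =ᶠ[𝓝 z₀] twist K := by
      filter_upwards [isOpen_ne.mem_nhds hz₀] with z hz
      exact (heq z hz).symm
    refine ContinuousAt.congr ?_ hev
    have h3 : ContinuousAt (fun z => blend K (clamp ‖z‖) (τ z)) z₀ :=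
      hB.continuousAt.comp ((continuous_clamp.continuousAt.comp continuous_norm.continuousAt).prodMk hτc)
    exact (continuous_ofReal.continuousAt.comp continuous_norm.continuousAt).mul
      (continuous_turn.continuousAt.comp h3)

include hKm hK1 in
/-- The twist is injective. [folklore] -/
theorem injective_twist : Function.Injective (twist K) := by
  intro z w h
  have hn : ‖z‖ = ‖w‖ := by rw [← norm_twist (K := K) z, h, norm_twist]
  rcases eq_or_ne z 0 with rfl | hz
  · rw [norm_zero] at hn; exact (norm_eq_zero.1 hn.symm).symm
  · have hρ : 0 < ‖z‖ := norm_pos_iff.2 hz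
    have hz' := norm_mul_turn_arg z
    have hw' := norm_mul_turn_arg w
    rw [← hz', ← hw', ← hn, twist_polar hK1 hρ.le, twist_polar hK1 hρ.le] at h
    have h' : turn (blend K (clamp ‖z‖) (arg z / (2 * π))) =
        turn (blend K (clamp ‖z‖) (arg w / (2 * π))) :=
      mul_left_cancel₀ (by exact_mod_cast hρ.ne') h
    obtain ⟨n, hn'⟩ := turn_eq_turn_iff.1 h'
    rw [← blend_add_intCast hK1] at hn'
    have := (strictMono_blend hKm (clamp_mem ‖z‖)).injective hn'
    rw [← hz', ← hw', ← hn, this, turn_add_intCast]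

include hKc hK1 in
/-- The twist is surjective. [folklore] -/
theorem surjective_twist : Function.Surjective (twist K) := by
  intro w
  rcases eq_or_ne w 0 with rfl | hw
  · exact ⟨0, by simp [twist]⟩
  · set ρ := ‖w‖ with hρ
    have hρ0 : 0 < ρ := norm_pos_iff.2 hw
    obtain ⟨σ, hσ⟩ : ∃ σ, turn σ = w / ρ := exists_turn_eq (by
      rw [norm_div, Complex.norm_real, Real.norm_eq_abs, abs_of_pos hρ0, hρ, div_self hρ0.ne'])
    obtain ⟨t, ht⟩ := surjective_blend hKc hK1 (clamp ρ) σ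
    refine ⟨ρ * turn t, ?_⟩
    rw [twist_polar hK1 hρ0.le, ht, hσ]
    exact mul_div_cancel₀ w (by exact_mod_cast hρ0.ne')

include hKc hKm hK1 in
/-- **The twist is a homeomorphism of `ℂ`** (continuous, bijective, proper since
norm-preserving). [folklore] -/
theorem isHomeomorph_twist : IsHomeomorph (twist K) := by
  have hc := continuous_twist hKc hK1
  have hprop : Tendsto (twist K) (cocompact ℂ) (cocompact ℂ) := by
    refine Filter.tendsto_cocompact_cocompact_of_norm fun ε => ⟨ε, fun z hz => ?_⟩
    rwa [norm_twist]
  exact isHomeomorph_iff_continuous_isClosedMap_bijective.2 ⟨hc,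
    (isProperMap_iff_tendsto_cocompact.2 ⟨hc, hprop⟩).isClosedMap,
    injective_twist hKm hK1, surjective_twist hKc hK1⟩

end Twist

end CircleTwist

open CircleTwist

/-! ### The extension theorem -/

/-- Images of round balls, spheres and their complements under a norm-preserving bijection of
`ℂ`. [folklore] -/
theorem image_eq_of_norm_eq {Φ : ℂ → ℂ} (hΦ : Function.Bijective Φ) (hn : ∀ z, ‖Φ z‖ = ‖z‖)
    {p : ℝ → Prop} : Φ '' {z | p ‖z‖} = {z | p ‖z‖} := by
  ext w
  constructor
  · rintro ⟨z, hz, rfl⟩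
    simpa [hn] using hz
  · intro hw
    obtain ⟨z, rfl⟩ := hΦ.2 w
    exact ⟨z, by simpa [hn] using hw, rfl⟩

/-- **Extension of circle homeomorphisms over an annulus, up to conjugation** (Kneser 1926;
Moise 1977, Ch. 11, Thm. 4: a homeomorphism of the circle is isotopic to the identity or to a
reflection). Every homeomorphism `k` of the circle `‖z‖ = 2` onto itself is the restriction of a
norm-preserving homeomorphism `Φ` of `ℂ` which on the closed unit disc is either the identity
or complex conjugation. (If the lift of `k` is increasing, `Φ` is the twist of `k`; otherwise the
twist of `k ∘ conj` followed by `conj`.) [folklore] -/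
theorem exists_homeomorph_extend_circle {k : ℂ → ℂ} (hkc : ContinuousOn k (sphere 0 2))
    (hk : BijOn k (sphere 0 2) (sphere 0 2)) :
    ∃ Φ : ℂ ≃ₜ ℂ, EqOn Φ k (sphere 0 2) ∧ (∀ z, ‖Φ z‖ = ‖z‖) ∧
      ((∀ z, ‖z‖ ≤ 1 → Φ z = z) ∨ (∀ z, ‖z‖ ≤ 1 → Φ z = (starRingEnd ℂ) z)) := by
  obtain ⟨K, hKc, hKk, d, hKd⟩ := exists_lift_circle hkc hk.mapsTo
  have hsph : ∀ t : ℝ, 2 * turn t ∈ sphere (0 : ℂ) 2 := fun t => by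
    simp [norm_turn]
  -- injectivity of `k` in terms of the lift
  have hinj : ∀ s t, turn (K s) = turn (K t) → turn s = turn t := fun s t h => by
    have : k (2 * turn s) = k (2 * turn t) := by rw [hKk, hKk, h]
    exact mul_left_cancel₀ two_ne_zero (hk.injOn (hsph s) (hsph t) this)
  have hinjIoo : InjOn K (Ioo 0 1) := by
    intro s hs t ht h
    obtain ⟨n, hn⟩ := turn_eq_turn_iff.1 (hinj s t (by rw [h]))
    have : (n : ℝ) = 0 := by
      have h1 : (-1 : ℝ) < n := by linarith [hs.1, ht.2]
      have h2 : (n : ℝ) < 1 := by linarith [hs.2, ht.1]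
      have : (-1 : ℤ) < n := by exact_mod_cast h1
      have : n < (1 : ℤ) := by exact_mod_cast h2
      exact_mod_cast (show n = 0 by omega)
    rw [this, add_zero] at hn
    exact hn
  -- every point of the circle of radius 2 is `2 turn t`
  have hpt : ∀ z ∈ sphere (0 : ℂ) 2, ∃ t, z = 2 * turn t := fun z hz => by
    have hz2 : ‖z‖ = 2 := mem_sphere_zero_iff_norm.1 hz
    obtain ⟨t, ht⟩ := exists_turn_eq (w := z / 2) (by rw [norm_div, hz2]; norm_num)
    exact ⟨t, by rw [ht]; ring⟩
  rcases hKc.continuousOn.strictMonoOn_of_injOn_Ioo zero_lt_one hinjIoo with hmono | hanti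
  · -- increasing lift: the twist of `k`
    obtain ⟨hd, hKm⟩ := strictMono_of_lift hKc hKd hmono hinj
    subst hd
    simp only [Int.cast_one] at hKd
    set Φ := (isHomeomorph_twist hKc hKm hKd).homeomorph (twist K) with hΦ
    refine ⟨Φ, fun z hz => ?_, fun z => norm_twist z, Or.inl fun z hz => twist_of_norm_le_one hz⟩
    obtain ⟨t, rfl⟩ := hpt z hz
    show twist K (2 * turn t) = k (2 * turn t)
    rw [hKk, show (2 : ℂ) = ((2 : ℝ) : ℂ) by norm_num, twist_polar_of_two_le hKd le_rfl]
  · -- decreasing lift: twist `k ∘ conj`, then conjugate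
    set K' : ℝ → ℝ := fun t => K (-t) with hK'
    have hK'c : Continuous K' := hKc.comp continuous_neg
    have hK'd : ∀ t, K' (t + 1) = K' t + (-d : ℤ) := fun t => by
      have := hKd (-t - 1)
      simp only [hK', Int.cast_neg, neg_add_rev]
      rw [show -t - 1 + 1 = -t by ring] at this
      rw [show -1 + -t = -t - 1 by ring]
      linarith
    have hK'm : StrictMonoOn K' (Ioo 0 1) := by
      intro s hs t ht hst
      simp only [hK']
      have h1 : K (-t) = K (-t + 1) - d := by rw [hKd]; ring
      have h2 : K (-s) = K (-s + 1) - d := by rw [hKd]; ring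
      rw [h1, h2]
      have := hanti ⟨by linarith [ht.2], by linarith [ht.1]⟩ ⟨by linarith [hs.2], by linarith [hs.1]⟩
        (by linarith : -t + 1 < -s + 1)
      linarith
    have hinj' : ∀ s t, turn (K' s) = turn (K' t) → turn s = turn t := fun s t h => by
      have := hinj (-s) (-t) h
      rw [turn_neg, turn_neg] at this
      simpa using congrArg (starRingEnd ℂ) this
    obtain ⟨hd, hK'mono⟩ := strictMono_of_lift hK'c hK'd hK'm hinj'
    have hK'1 : ∀ t, K' (t + 1) = K' t + 1 := fun t => by
      have := hK'd t; rw [hd] at this; simpa using this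
    set Ψ := (isHomeomorph_twist hK'c hK'mono hK'1).homeomorph (twist K') with hΨ
    -- complex conjugation as a homeomorphism
    set C : ℂ ≃ₜ ℂ := conjLIE.toHomeomorph with hC
    have hCapply : ∀ z, C z = (starRingEnd ℂ) z := fun z => rfl
    refine ⟨C.trans Ψ, fun z hz => ?_, fun z => ?_, Or.inr fun z hz => ?_⟩
    · obtain ⟨t, rfl⟩ := hpt z hz
      show twist K' (C (2 * turn t)) = k (2 * turn t)
      have e : C (2 * turn t) = ((2 : ℝ) : ℂ) * turn (-t) := by
        rw [hCapply, map_mul, turn_neg, show (2 : ℂ) = ((2 : ℝ) : ℂ) by norm_num,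
          Complex.conj_ofReal]
      rw [e, twist_polar_of_two_le hK'1 le_rfl]
      show ((2 : ℝ) : ℂ) * turn (K (- -t)) = k (2 * turn t)
      rw [neg_neg, hKk]
      norm_num
    · show ‖twist K' (C z)‖ = ‖z‖
      rw [norm_twist, hCapply, Complex.norm_conj]
    · show twist K' (C z) = (starRingEnd ℂ) z
      rw [hCapply, twist_of_norm_le_one (by rwa [Complex.norm_conj])]

end Literature.Topology.PlaneTopology

end
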